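import Mathlib.RingTheory.PowerSeries.Derivative
import Mathlib.RingTheory.PowerSeries.Inverse
import Mathlib.Tactic.FieldSimp
import Mathlib.Tactic.Ring
import Mathlib.Tactic.Linarith
import HarnessLib

/-!
# Formal power-series solutions of first-order linear differential equations `u φ′ = v φ`

`Literature/RingTheory/PowerSeries/FormalLinearODESolution.lean` — everything PROVED. Over a
field `K` of characteristic zero, for every `r ∈ K⟦X⟧` the equation `φ′ = r φ` has a formal
solution with `φ(0) = 1` (`exists_derivative_eq_mul`; `φ = exp ∫ r`, built here by the coefficient
recursion `(n+1) φₙ₊₁ = ∑_{i≤n} rᵢ φₙ₋ᵢ`, `odeSolCoeff`), hence so has `u φ′ = v φ` whenever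
`u(0) ≠ 0` (`exists_mul_derivative_eq_mul`). This is the formal counterpart of Cauchy's theorem
at a REGULAR point of a first-order linear equation, used to produce the power-series solution
`zˢ e^{1/(cz)}` (expanded at `z = 1`) of `c z² φ′ = (scz − 1) φ` in
`Literature/NumberTheory/Transcendental/FischlerRivoalCorollary1OfAndre.lean`. Definitions:
`odeSolPrefix` (the recursion, structural in the truncation order) and `odeSolCoeff`.
-/

noncomputable section

open Finset PowerSeries

namespace Literature.RingTheory.PowerSeries


variable {K : Type*} [Field K] [CharZero K]

/-- Prefixes of the coefficient sequence of the solution of `φ′ = r φ`, `φ(0) = 1`: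
`pre r n` is correct in the indices `≤ n` (structural recursion on `n`). [folklore] -/
def odeSolPrefix (r : ℕ → K) : ℕ → ℕ → K
  | 0 => fun k => if k = 0 then 1 else 0
  | n + 1 => Function.update (odeSolPrefix r n) (n + 1)
      (((n : K) + 1)⁻¹ * ∑ i ∈ Finset.range (n + 1), r i * odeSolPrefix r n (n - i))

/-- The coefficient sequence `φₙ = odeSolPrefix r n n`. [folklore] -/
def odeSolCoeff (r : ℕ → K) (n : ℕ) : K := odeSolPrefix r n n

omit [CharZero K] in
/-- Stability of the prefixes: `odeSolPrefix r n k = odeSolCoeff r k` for `k ≤ n`. [folklore] -/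
theorem odeSolPrefix_eq_odeSolCoeff (r : ℕ → K) {n k : ℕ} (hk : k ≤ n) : odeSolPrefix r n k = odeSolCoeff r k := by
  induction n with
  | zero =>
    obtain rfl : k = 0 := Nat.le_zero.mp hk
    rfl
  | succ n ih =>
    rcases Nat.lt_or_eq_of_le hk with h | rfl
    · rw [odeSolPrefix, Function.update_of_ne (by omega)]
      exact ih (by omega)
    · rfl

omit [CharZero K] in
/-- `φ₀ = 1`. [folklore] -/
theorem odeSolCoeff_zero (r : ℕ → K) : odeSolCoeff r 0 = 1 := rfl

omit [CharZero K] in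
/-- The defining recursion `(n+1) φₙ₊₁ = ∑_{i ≤ n} rᵢ φₙ₋ᵢ` (before dividing). [folklore] -/
theorem odeSolCoeff_succ (r : ℕ → K) (n : ℕ) :
    odeSolCoeff r (n + 1) = ((n : K) + 1)⁻¹ * ∑ i ∈ Finset.range (n + 1), r i * odeSolCoeff r (n - i) := by
  rw [odeSolCoeff, odeSolPrefix, Function.update_self]
  congr 1
  refine Finset.sum_congr rfl fun i hi => ?_
  rw [odeSolPrefix_eq_odeSolCoeff r (Nat.sub_le n i)]

/-- **Formal solutions of `φ′ = r φ`.** For every `r ∈ K⟦X⟧` (`K` a field of characteristic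
zero) there is a formal power series `φ` with `φ(0) = 1` and `φ′ = r·φ` (coefficients by the
recursion `(n+1)φₙ₊₁ = ∑ rᵢ φₙ₋ᵢ`; `φ = exp ∫r`). PROVED. [folklore] -/
theorem exists_derivative_eq_mul (r : K⟦X⟧) :
    ∃ φ : K⟦X⟧, constantCoeff φ = 1 ∧ derivative K φ = r * φ := by
  refine ⟨PowerSeries.mk (odeSolCoeff fun i => coeff i r), ?_, ?_⟩
  · rw [← coeff_zero_eq_constantCoeff_apply, coeff_mk, odeSolCoeff_zero]
  · ext n
    rw [coeff_derivative, coeff_mk, odeSolCoeff_succ, coeff_mul,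
      Finset.Nat.sum_antidiagonal_eq_sum_range_succ (fun i j => coeff i r * coeff j (PowerSeries.mk _))]
    simp only [coeff_mk]
    have hn : ((n : K) + 1) ≠ 0 := by exact_mod_cast Nat.succ_ne_zero n
    field_simp

/-- **Formal solutions of `u φ′ = v φ` with `u(0) ≠ 0`.** PROVED. [folklore] -/
theorem exists_mul_derivative_eq_mul (u v : K⟦X⟧) (hu : constantCoeff u ≠ 0) :
    ∃ φ : K⟦X⟧, constantCoeff φ = 1 ∧ u * derivative K φ = v * φ := by
  obtain ⟨φ, h0, hφ⟩ := exists_derivative_eq_mul (v * u⁻¹)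
  refine ⟨φ, h0, ?_⟩
  rw [hφ]
  calc u * (v * u⁻¹ * φ) = v * (u * u⁻¹) * φ := by ring
    _ = v * φ := by rw [PowerSeries.mul_inv_cancel u hu, mul_one]

end Literature.RingTheory.PowerSeries

end
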